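import Literature.Computability.Cryptography.NaorReingoldReduction
import Literature.Computability.Cryptography.UniformModQ
import HarnessLib

/-!
# The ends of the Naor–Reingold hybrid chain: key sampling, the random level and hashing

Continuation of `NaorReingoldReduction.lean` (levels `0 … n` of the truth-table hybrid argument
are `n 2ⁿ ε`-close when `B₂`-circuits of size `simSize T` have DDH advantage `≤ ε`). Here the two
ends are tied to the actual experiment of a truth-table distinguisher `T`:

* `uProb_hybTable_zero` — level `0` IS the hashed Naor–Reingold function with a uniform key
  `a ∈ ℤ_Q^{n+1}` and hash key `r` (`keyTable`; NR p. 251, "`Pr[D = 1 | J = 1] = Pr[M^{f} = 1]`");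
* `abs_uProb_hybTable_n_sub_uniform_le` — level `n` is the table `(⟨r, bin(g^{R(x)})⟩)_x` of a
  uniformly random function `R` into `⟨g⟩`, hashed; by the hashing lemma
  (`abs_uProb_innerTables_sub_le`, the truth-table form of Construction 4.2 / Thm. 4.3) it is
  `2ⁿ/(2√Q)`-far from a uniform `2ⁿ`-bit table (NR p. 251, "`Pr[D = 1 | J = n] = Pr[M^{R} = 1]`",
  and p. 246);
* `abs_uProb_seedTable_sub_keyTable_le` — keys sampled from uniform BIT STRINGS (`n+1` blocks of
  `L` bits read as numbers and used as exponents, which only matter modulo `Q = ord g`) instead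
  of uniform elements of `ℤ_Q` change the acceptance probability by `≤ (n+1) Q / 2^L`
  (`abs_uProb_finMod_sub_le`, one coordinate at a time);
* `abs_uProb_seedTable_sub_uniform_le` — **the total bound**
  `|Pr_{K,r}[T(table of the hashed f_{P,Q,g,K} )] - Pr_y[T y]| ≤ (n+1)Q/2^L + n 2ⁿ ε + 2ⁿ/(2√Q)`.

## References

* M. Naor, O. Reingold, J. ACM 51 (2004), Construction 4.1–4.2, Thm. 4.1, Lemma 4.2, Thm. 4.3
  (pp. 245–251).
* S. Arora, B. Barak, *Computational Complexity: A Modern Approach*, CUP 2009, §23.3.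
-/

noncomputable section

namespace Literature.Computability.Cryptography

open Finset Literature.Computability.MetaComplexity Literature.Computability.Complexity

namespace NaorReingold

namespace Params

variable (pp : Params)

/-! ### Level `0` is the keyed construction -/

/-- The position of `0ⁿ` in the enumeration of the cube. [folklore] -/
def p₀ : Fin (2 ^ pp.n) := pp.idx fun _ => false

/-- The key space of the hashed construction: exponents `a ∈ ℤ_Q^{n+1}` and hash key `r`. [cite: NaorReingold2004, Construction 4.1–4.2 (pp. 245–246)] -/
abbrev KeyΩ : Type := (Fin (pp.n + 1) → Fin pp.Q) × (Fin pp.m → Bool)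

/-- Reassembly of the hybrid sample space as (key of level `0`) × (unused randomness). [folklore] -/
def keyEquiv : pp.HΩ ≃ pp.KeyΩ × (({p : Fin (2 ^ pp.n) // p ≠ pp.p₀} → Fin pp.Q) × Fin pp.Q) where
  toFun ω := ((Fin.cons (ω.1 pp.p₀) (Fin.tail ω.2.1), ω.2.2), (fun q => ω.1 q.val, ω.2.1 0))
  invFun q := (fun p => if h : p = pp.p₀ then q.1.1 0 else q.2.1 ⟨p, h⟩, Fin.cons q.2.2 (Fin.tail q.1.1), q.1.2)
  left_inv ω := by
    obtain ⟨R, a, r⟩ := ω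
    refine Prod.ext ?_ (Prod.ext ?_ rfl)
    · funext p
      by_cases h : p = pp.p₀
      · subst h; simp
      · simp [h]
    · simp only [Fin.tail_cons, Fin.cons_self_tail]
  right_inv q := by
    obtain ⟨⟨a', r⟩, R₀, α₀⟩ := q
    refine Prod.ext (Prod.ext ?_ rfl) (Prod.ext ?_ ?_)
    · simp
    · funext q; simp [q.prop]
    · simp

variable {pp}

/-- **Level `0` has the acceptance probability of the keyed construction.** [cite: NaorReingold2004, proof of Thm. 4.1 (p. 251)] -/
theorem uProb_hybTable_zero (T : (Fin (2 ^ pp.n) → Bool) → Bool) :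
    uProb (fun ω : pp.HΩ => T (pp.hybTable 0 ω)) = uProb (fun κ : pp.KeyΩ => T (pp.keyTable κ.1 κ.2)) := by
  rw [← uProb_comp_equiv pp.keyEquiv.symm (fun ω : pp.HΩ => T (pp.hybTable 0 ω))]
  have h : (fun q : pp.KeyΩ × (({p : Fin (2 ^ pp.n) // p ≠ pp.p₀} → Fin pp.Q) × Fin pp.Q) =>
      T (pp.hybTable 0 (pp.keyEquiv.symm q))) = fun q => (fun κ : pp.KeyΩ => T (pp.keyTable κ.1 κ.2)) q.1 := by
    funext q
    rw [hybTable_zero]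
    have h1 := pp.keyEquiv.apply_symm_apply q
    have h2 : pp.keyEquiv (pp.keyEquiv.symm q) =
        ((Fin.cons ((pp.keyEquiv.symm q).1 pp.p₀) (Fin.tail (pp.keyEquiv.symm q).2.1), (pp.keyEquiv.symm q).2.2),
          (fun q' => (pp.keyEquiv.symm q).1 q'.val, (pp.keyEquiv.symm q).2.1 0)) := rfl
    rw [h2] at h1
    have h3 := congrArg Prod.fst h1
    simp only at h3
    rw [← h3]
    rfl
  rw [h]
  exact uProb_fst (Ω' := ({p : Fin (2 ^ pp.n) // p ≠ pp.p₀} → Fin pp.Q) × Fin pp.Q)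
    fun κ : pp.KeyΩ => T (pp.keyTable κ.1 κ.2)

/-! ### Level `n`: a random function into `⟨g⟩`, hashed -/

/-- The randomness read at level `n`: the hash key and the random function. [folklore] -/
def lastEquiv (pp : Params) : ((Fin pp.m → Bool) × (Fin (2 ^ pp.n) → Fin pp.Q)) × (Fin (pp.n + 1) → Fin pp.Q) ≃ pp.HΩ where
  toFun q := (q.1.2, q.2, q.1.1)
  invFun ω := ((ω.2.2, ω.1), ω.2.1)
  left_inv _ := rfl
  right_inv _ := rfl

/-- Level `n` has the acceptance probability of the hashed table of a uniformly random function
into `⟨g⟩`. [cite: NaorReingold2004, proof of Thm. 4.1 (p. 251)] -/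
theorem uProb_hybTable_n (T : (Fin (2 ^ pp.n) → Bool) → Bool) :
    uProb (fun ω : pp.HΩ => T (pp.hybTable pp.n ω)) =
      uProb (fun ω : (Fin pp.m → Bool) × (Fin (2 ^ pp.n) → Fin pp.Q) =>
        T fun t => innerBit ω.1 (pp.bits (pp.gpow (ω.2 t).val))) := by
  rw [← uProb_comp_equiv pp.lastEquiv (fun ω : pp.HΩ => T (pp.hybTable pp.n ω))]
  simp only [hybTable_n]
  exact uProb_fst (Ω' := Fin (pp.n + 1) → Fin pp.Q)
    fun ω : (Fin pp.m → Bool) × (Fin (2 ^ pp.n) → Fin pp.Q) => T fun t => innerBit ω.1 (pp.bits (pp.gpow (ω.2 t).val))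

/-- Distinct exponents below the order give distinct powers, and group elements below `2^m` have
distinct bit strings: `v ↦ bin(g^v)` is injective on `ℤ_Q`. [folklore] -/
theorem bits_gpow_injective [NeZero pp.P] (hP : pp.P ≤ 2 ^ pp.m) (hord : orderOf (pp.g : ZMod pp.P) = pp.Q) :
    Function.Injective fun v : Fin pp.Q => pp.bits (pp.gpow v.val) := by
  intro v w hvw
  have hval : (pp.gpow v.val).val = (pp.gpow w.val).val := by
    apply Nat.eq_of_testBit_eq
    intro l
    by_cases hl : l < pp.m
    · exact congrFun hvw ⟨l, hl⟩
    · have hlt : ∀ u : ZMod pp.P, u.val < 2 ^ l := fun u =>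
        (ZMod.val_lt u).trans_le (hP.trans (Nat.pow_le_pow_right (by norm_num) (by omega)))
      rw [Nat.testBit_eq_false_of_lt (hlt _), Nat.testBit_eq_false_of_lt (hlt _)]
  have hpow : pp.gpow v.val = pp.gpow w.val := ZMod.val_injective _ hval
  unfold gpow at hpow
  have hv : v.val ∈ Set.Iio (orderOf (pp.g : ZMod pp.P)) := by rw [hord]; exact v.isLt
  have hw : w.val ∈ Set.Iio (orderOf (pp.g : ZMod pp.P)) := by rw [hord]; exact w.isLt
  exact Fin.ext (pow_injOn_Iio_orderOf hv hw hpow)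

/-- **Level `n` versus a uniform table** (the hashing step): `≤ 2ⁿ / (2 √Q)`. [cite: NaorReingold2004, Lemma 4.2 and Thm. 4.3 (p. 246)] -/
theorem abs_uProb_hybTable_n_sub_uniform_le [NeZero pp.P] (hP : pp.P ≤ 2 ^ pp.m)
    (hord : orderOf (pp.g : ZMod pp.P) = pp.Q) (T : (Fin (2 ^ pp.n) → Bool) → Bool) :
    |uProb (fun ω : pp.HΩ => T (pp.hybTable pp.n ω)) - uProb (fun y : Fin (2 ^ pp.n) → Bool => T y)| ≤
      (2 ^ pp.n : ℕ) / (2 * Real.sqrt pp.Q) := by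
  rw [uProb_hybTable_n]
  have h := abs_uProb_innerTables_sub_le (N := 2 ^ pp.n) (fun v : Fin pp.Q => pp.bits (pp.gpow v.val))
    (bits_gpow_injective hP hord) T
  rw [Fintype.card_fin] at h
  exact_mod_cast h

/-! ### Keys from uniform bit strings -/

variable (pp)

/-- The table of the hashed construction keyed by `n + 1` blocks of `L` uniform bits, each read as
a number `K_i < 2^L` and used as the exponent `a_i` (only `K_i mod Q` matters). [cite: NaorReingold2004, Construction 4.1 (p. 245: "a is uniform in its range")] -/
def seedTable (L : ℕ) (K : Fin (pp.n + 1) → Fin (2 ^ L)) (r : Fin pp.m → Bool) : Fin (2 ^ pp.n) → Bool :=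
  fun t => pp.hashBit r (nrFun pp.P pp.g (fun i => (K i).val) (pp.idx.symm t))

variable {pp}

/-- The Naor–Reingold function only depends on the key exponents modulo `Q` (as `g^Q = 1`). [cite: NaorReingold2004, Construction 4.1 (p. 245)] -/
theorem nrFun_mod (hg : pp.gpow pp.Q = 1) (a : Fin (pp.n + 1) → ℕ) (x : Fin pp.n → Bool) :
    nrFun pp.P pp.g a x = nrFun pp.P pp.g (fun i => a i % pp.Q) x := by
  change pp.gpow _ = pp.gpow _
  rw [gpow_eq_gpow_mod hg, gpow_eq_gpow_mod hg (_ * _)]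
  congr 1
  refine (ZMod.natCast_eq_natCast_iff' _ _ pp.Q).1 ?_
  push_cast
  congr 1
  · rw [ZMod.natCast_mod]
  · refine Finset.prod_congr rfl fun i _ => ?_
    split <;> simp [ZMod.natCast_mod]

/-- The seed table is the key table of the reduced key. [cite: NaorReingold2004, Construction 4.1 (p. 245)] -/
theorem seedTable_eq_keyTable (hg : pp.gpow pp.Q = 1) (L : ℕ) (K : Fin (pp.n + 1) → Fin (2 ^ L)) (r : Fin pp.m → Bool) :
    pp.seedTable L K r = pp.keyTable (fun i => finMod pp.Q_pos (K i)) r := by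
  funext t
  simp only [seedTable, keyTable, nrFun_mod hg (fun i => (K i).val)]
  rfl

variable (pp)

/-- The sample space of the key-smoothing hybrids: bit-string keys, `ℤ_Q` keys, hash key. [folklore] -/
abbrev SΩ (L : ℕ) : Type := (Fin (pp.n + 1) → Fin (2 ^ L)) × (Fin (pp.n + 1) → Fin pp.Q) × (Fin pp.m → Bool)

/-- The `c`-th smoothing hybrid key: the first `c` exponents uniform in `ℤ_Q`, the others reduced
bit strings. [folklore] -/
def mixKey {L : ℕ} (c : ℕ) (K : Fin (pp.n + 1) → Fin (2 ^ L)) (v : Fin (pp.n + 1) → Fin pp.Q) : Fin (pp.n + 1) → Fin pp.Q :=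
  fun i => if i.val < c then v i else finMod pp.Q_pos (K i)

/-- Its table. [folklore] -/
def mixTable {L : ℕ} (c : ℕ) (ω : pp.SΩ L) : Fin (2 ^ pp.n) → Bool := pp.keyTable (pp.mixKey c ω.1 ω.2.1) ω.2.2

/-- The rest of the smoothing space once coordinate `c` of both key vectors is removed. [folklore] -/
abbrev SRest (L : ℕ) (c : Fin (pp.n + 1)) : Type :=
  ({i : Fin (pp.n + 1) // i ≠ c} → Fin (2 ^ L)) × ({i : Fin (pp.n + 1) // i ≠ c} → Fin pp.Q) × (Fin pp.m → Bool)

/-- The key of hybrid `c` / `c + 1` with everything but coordinate `c` fixed and the value `w` at `c`. [folklore] -/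
def mixKeyAt {L : ℕ} (c : Fin (pp.n + 1)) (ρ : pp.SRest L c) (w : Fin pp.Q) : Fin (pp.n + 1) → Fin pp.Q :=
  fun i => if h : i = c then w else if i.val < c.val then ρ.2.1 ⟨i, h⟩ else finMod pp.Q_pos (ρ.1 ⟨i, h⟩)

/-- Reassembly of the smoothing space around coordinate `c`. [folklore] -/
def mixEquiv (L : ℕ) (c : Fin (pp.n + 1)) : pp.SRest L c × (Fin (2 ^ L) × Fin pp.Q) ≃ pp.SΩ L where
  toFun q := (fun i => if h : i = c then q.2.1 else q.1.1 ⟨i, h⟩,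
    fun i => if h : i = c then q.2.2 else q.1.2.1 ⟨i, h⟩, q.1.2.2)
  invFun ω := ((fun i => ω.1 i.val, fun i => ω.2.1 i.val, ω.2.2), (ω.1 c, ω.2.1 c))
  left_inv q := by
    obtain ⟨⟨K', v', r⟩, κ, ν⟩ := q
    refine Prod.ext (Prod.ext ?_ (Prod.ext ?_ rfl)) (Prod.ext (by simp) (by simp))
    · funext i; simp [i.prop]
    · funext i; simp [i.prop]
  right_inv ω := by
    obtain ⟨K, v, r⟩ := ω
    refine Prod.ext ?_ (Prod.ext ?_ rfl)
    · funext i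
      by_cases h : i = c
      · subst h; simp
      · simp [h]
    · funext i
      by_cases h : i = c
      · subst h; simp
      · simp [h]

variable {pp}

/-- Unfolding of `mixKey`. [folklore] -/
theorem mixKey_apply {L : ℕ} (c : ℕ) (K : Fin (pp.n + 1) → Fin (2 ^ L)) (v : Fin (pp.n + 1) → Fin pp.Q) (i : Fin (pp.n + 1)) :
    pp.mixKey c K v i = if i.val < c then v i else finMod pp.Q_pos (K i) := rfl

/-- The bit-string key component of the reassembly. [folklore] -/
theorem mixEquiv_apply_fst {L : ℕ} (c : Fin (pp.n + 1)) (q : pp.SRest L c × (Fin (2 ^ L) × Fin pp.Q)) (i : Fin (pp.n + 1)) :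
    (pp.mixEquiv L c q).1 i = if h : i = c then q.2.1 else q.1.1 ⟨i, h⟩ := rfl

/-- The `ℤ_Q` key component of the reassembly. [folklore] -/
theorem mixEquiv_apply_snd_fst {L : ℕ} (c : Fin (pp.n + 1)) (q : pp.SRest L c × (Fin (2 ^ L) × Fin pp.Q)) (i : Fin (pp.n + 1)) :
    (pp.mixEquiv L c q).2.1 i = if h : i = c then q.2.2 else q.1.2.1 ⟨i, h⟩ := rfl

/-- The hash key component of the reassembly. [folklore] -/
theorem mixEquiv_apply_snd_snd {L : ℕ} (c : Fin (pp.n + 1)) (q : pp.SRest L c × (Fin (2 ^ L) × Fin pp.Q)) :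
    (pp.mixEquiv L c q).2.2 = q.1.2.2 := rfl

/-- Unfolding of `mixKeyAt`. [folklore] -/
theorem mixKeyAt_apply {L : ℕ} (c : Fin (pp.n + 1)) (ρ : pp.SRest L c) (w : Fin pp.Q) (i : Fin (pp.n + 1)) :
    pp.mixKeyAt c ρ w i = if h : i = c then w else if i.val < c.val then ρ.2.1 ⟨i, h⟩ else finMod pp.Q_pos (ρ.1 ⟨i, h⟩) := rfl

/-- Hybrid `0` uses the reduced bit strings everywhere. [folklore] -/
theorem mixKey_zero {L : ℕ} (K : Fin (pp.n + 1) → Fin (2 ^ L)) (v : Fin (pp.n + 1) → Fin pp.Q) :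
    pp.mixKey 0 K v = fun i => finMod pp.Q_pos (K i) := by
  funext i; simp [mixKey_apply]

/-- Hybrid `n + 1` uses the `ℤ_Q` key everywhere. [folklore] -/
theorem mixKey_last {L : ℕ} (K : Fin (pp.n + 1) → Fin (2 ^ L)) (v : Fin (pp.n + 1) → Fin pp.Q) :
    pp.mixKey (pp.n + 1) K v = v := by
  funext i; simp [mixKey_apply, i.isLt]

/-- Hybrid `c` through the reassembly reads `finMod κ` at coordinate `c`. [folklore] -/
theorem mixKey_mixEquiv {L : ℕ} (c : Fin (pp.n + 1)) (q : pp.SRest L c × (Fin (2 ^ L) × Fin pp.Q)) :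
    pp.mixKey c.val (pp.mixEquiv L c q).1 (pp.mixEquiv L c q).2.1 = pp.mixKeyAt c q.1 (finMod pp.Q_pos q.2.1) := by
  funext i
  rw [mixKey_apply, mixEquiv_apply_fst, mixEquiv_apply_snd_fst, mixKeyAt_apply]
  by_cases h : i = c
  · subst h; simp
  · have hv : i.val ≠ c.val := fun h' => h (Fin.ext h')
    simp only [dif_neg h]

/-- Hybrid `c + 1` through the reassembly reads `ν` at coordinate `c`. [folklore] -/
theorem mixKey_succ_mixEquiv {L : ℕ} (c : Fin (pp.n + 1)) (q : pp.SRest L c × (Fin (2 ^ L) × Fin pp.Q)) :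
    pp.mixKey (c.val + 1) (pp.mixEquiv L c q).1 (pp.mixEquiv L c q).2.1 = pp.mixKeyAt c q.1 q.2.2 := by
  funext i
  rw [mixKey_apply, mixEquiv_apply_fst, mixEquiv_apply_snd_fst, mixKeyAt_apply]
  by_cases h : i = c
  · subst h; simp
  · have hv : i.val ≠ c.val := fun h' => h (Fin.ext h')
    have hiff : i.val < c.val + 1 ↔ i.val < c.val := by omega
    simp only [dif_neg h, hiff]

/-- **One smoothing step**: `|Pr[T(hybrid c)] - Pr[T(hybrid c+1)]| ≤ Q / 2^L`. [cite: Goldreich2001, §1.3] -/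
theorem abs_uProb_mixTable_step_le {L : ℕ} (T : (Fin (2 ^ pp.n) → Bool) → Bool) (c : Fin (pp.n + 1)) :
    |uProb (fun ω : pp.SΩ L => T (pp.mixTable c.val ω)) - uProb (fun ω : pp.SΩ L => T (pp.mixTable (c.val + 1) ω))| ≤
      (pp.Q : ℝ) / 2 ^ L := by
  rw [← uProb_comp_equiv (pp.mixEquiv L c) (fun ω : pp.SΩ L => T (pp.mixTable c.val ω)),
    ← uProb_comp_equiv (pp.mixEquiv L c) (fun ω : pp.SΩ L => T (pp.mixTable (c.val + 1) ω))]
  have e1 : (fun q : pp.SRest L c × (Fin (2 ^ L) × Fin pp.Q) => T (pp.mixTable c.val (pp.mixEquiv L c q))) =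
      fun q => T (pp.keyTable (pp.mixKeyAt c q.1 (finMod pp.Q_pos q.2.1)) q.1.2.2) := by
    funext q; simp only [mixTable, mixKey_mixEquiv]; rfl
  have e2 : (fun q : pp.SRest L c × (Fin (2 ^ L) × Fin pp.Q) => T (pp.mixTable (c.val + 1) (pp.mixEquiv L c q))) =
      fun q => T (pp.keyTable (pp.mixKeyAt c q.1 q.2.2) q.1.2.2) := by
    funext q; simp only [mixTable, mixKey_succ_mixEquiv]; rfl
  rw [e1, e2]
  -- drop the unused coordinate on each side
  have d1 : uProb (fun q : pp.SRest L c × (Fin (2 ^ L) × Fin pp.Q) =>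
      T (pp.keyTable (pp.mixKeyAt c q.1 (finMod pp.Q_pos q.2.1)) q.1.2.2)) =
      uProb (fun q : pp.SRest L c × Fin (2 ^ L) => T (pp.keyTable (pp.mixKeyAt c q.1 (finMod pp.Q_pos q.2)) q.1.2.2)) := by
    rw [← uProb_comp_equiv (Equiv.prodAssoc (pp.SRest L c) (Fin (2 ^ L)) (Fin pp.Q))
      (fun q : pp.SRest L c × (Fin (2 ^ L) × Fin pp.Q) => T (pp.keyTable (pp.mixKeyAt c q.1 (finMod pp.Q_pos q.2.1)) q.1.2.2))]
    exact uProb_fst (Ω' := Fin pp.Q)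
      fun q : pp.SRest L c × Fin (2 ^ L) => T (pp.keyTable (pp.mixKeyAt c q.1 (finMod pp.Q_pos q.2)) q.1.2.2)
  have d2 : uProb (fun q : pp.SRest L c × (Fin (2 ^ L) × Fin pp.Q) => T (pp.keyTable (pp.mixKeyAt c q.1 q.2.2) q.1.2.2)) =
      uProb (fun q : pp.SRest L c × Fin pp.Q => T (pp.keyTable (pp.mixKeyAt c q.1 q.2) q.1.2.2)) := by
    rw [← uProb_comp_equiv ((Equiv.prodAssoc (pp.SRest L c) (Fin pp.Q) (Fin (2 ^ L))).trans
        (Equiv.prodCongr (Equiv.refl _) (Equiv.prodComm (Fin pp.Q) (Fin (2 ^ L)))))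
      (fun q : pp.SRest L c × (Fin (2 ^ L) × Fin pp.Q) => T (pp.keyTable (pp.mixKeyAt c q.1 q.2.2) q.1.2.2))]
    exact uProb_fst (Ω' := Fin (2 ^ L))
      fun q : pp.SRest L c × Fin pp.Q => T (pp.keyTable (pp.mixKeyAt c q.1 q.2) q.1.2.2)
  rw [d1, d2]
  refine abs_uProb_prod_sub_le (by positivity) fun ρ => ?_
  have h := abs_uProb_finMod_sub_le (B := 2 ^ L) pp.Q_pos (Nat.two_pow_pos L)
    (fun w : Fin pp.Q => T (pp.keyTable (pp.mixKeyAt c ρ w) ρ.2.2))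
  exact_mod_cast h

variable (pp) in
/-- Padding the seed space with the (unused) `ℤ_Q` key vector gives the smoothing space. [folklore] -/
def seedPad (L : ℕ) : ((Fin (pp.n + 1) → Fin (2 ^ L)) × (Fin pp.m → Bool)) × (Fin (pp.n + 1) → Fin pp.Q) ≃ pp.SΩ L where
  toFun q := (q.1.1, q.2, q.1.2)
  invFun ω := ((ω.1, ω.2.2), ω.2.1)
  left_inv _ := rfl
  right_inv _ := rfl

/-- **Keys from bit strings versus keys from `ℤ_Q`**: `≤ (n+1) Q / 2^L`. [cite: NaorReingold2004, Construction 4.1 (p. 245)] -/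
theorem abs_uProb_seedTable_sub_keyTable_le (hg : pp.gpow pp.Q = 1) (L : ℕ) (T : (Fin (2 ^ pp.n) → Bool) → Bool) :
    |uProb (fun ω : (Fin (pp.n + 1) → Fin (2 ^ L)) × (Fin pp.m → Bool) => T (pp.seedTable L ω.1 ω.2)) -
      uProb (fun κ : pp.KeyΩ => T (pp.keyTable κ.1 κ.2))| ≤ (pp.n + 1 : ℕ) * ((pp.Q : ℝ) / 2 ^ L) := by
  -- the two ends as smoothing hybrids `0` and `n + 1`
  have h0 : uProb (fun ω : (Fin (pp.n + 1) → Fin (2 ^ L)) × (Fin pp.m → Bool) => T (pp.seedTable L ω.1 ω.2)) =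
      uProb (fun ω : pp.SΩ L => T (pp.mixTable 0 ω)) := by
    rw [← uProb_comp_equiv (pp.seedPad L) (fun ω : pp.SΩ L => T (pp.mixTable 0 ω))]
    have : (fun q : ((Fin (pp.n + 1) → Fin (2 ^ L)) × (Fin pp.m → Bool)) × (Fin (pp.n + 1) → Fin pp.Q) =>
        T (pp.mixTable 0 (pp.seedPad L q))) = fun q => (fun ω : (Fin (pp.n + 1) → Fin (2 ^ L)) × (Fin pp.m → Bool) =>
          T (pp.seedTable L ω.1 ω.2)) q.1 := by
      funext q
      simp only [mixTable, mixKey_zero, seedTable_eq_keyTable hg]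
      rfl
    rw [this]
    exact (uProb_fst (Ω' := Fin (pp.n + 1) → Fin pp.Q)
      fun ω : (Fin (pp.n + 1) → Fin (2 ^ L)) × (Fin pp.m → Bool) => T (pp.seedTable L ω.1 ω.2)).symm
  have hN : uProb (fun κ : pp.KeyΩ => T (pp.keyTable κ.1 κ.2)) = uProb (fun ω : pp.SΩ L => T (pp.mixTable (pp.n + 1) ω)) := by
    have : (fun ω : pp.SΩ L => T (pp.mixTable (pp.n + 1) ω)) = fun ω => (fun κ : pp.KeyΩ => T (pp.keyTable κ.1 κ.2)) ω.2 := by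
      funext ω
      simp only [mixTable, mixKey_last]
    rw [this]
    exact (uProb_snd (Ω := Fin (pp.n + 1) → Fin (2 ^ L)) fun κ : pp.KeyΩ => T (pp.keyTable κ.1 κ.2)).symm
  rw [h0, hN]
  exact abs_uProb_sub_le_mul (fun c (ω : pp.SΩ L) => T (pp.mixTable c ω)) (pp.n + 1) fun c hc =>
    abs_uProb_mixTable_step_le T ⟨c, hc⟩

/-! ### The total bound -/

/-- **Naor–Reingold's Theorem 4.1 + 4.3, truth-table form with explicit constants.** Let
`⟨P, Q, g⟩` have `P ≤ 2^m`, `ord g = Q ≤ 2^m`, and suppose every `B₂`-circuit of size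
`≤ simSize T = 2ⁿ · entryCost m + |T|` has DDH advantage `≤ ε` against it. Then a truth-table test
`T` tells the `2ⁿ`-bit table of the hashed function `x ↦ ⟨r, bin(g^{K₀ ∏_{xᵢ=1} K_{i}})⟩` (keys:
`n + 1` uniform `L`-bit numbers `Kᵢ`, uniform `r ∈ {0,1}^m`) from a uniform table with advantage at
most `(n+1) Q / 2^L + n 2ⁿ ε + 2ⁿ / (2√Q)`. [cite: NaorReingold2004, Thm. 4.1 and Thm. 4.3 (pp. 245–251)] -/
theorem abs_uProb_seedTable_sub_uniform_le [NeZero pp.P] (hP : pp.P ≤ 2 ^ pp.m) (hQ : pp.Q ≤ 2 ^ pp.m)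
    (hord : orderOf (pp.g : ZMod pp.P) = pp.Q) (T : Circuit (Fin (2 ^ pp.n))) (hT : T.IsOver B2)
    {ε : ℝ} (hε : 0 ≤ ε)
    (H : ∀ C : Circuit (Fin 3 × Fin pp.m), C.IsOver B2 → C.size ≤ pp.simSize T →
      ddhAdvantage pp.m pp.P pp.Q pp.g C ≤ ε) (L : ℕ) :
    |uProb (fun ω : (Fin (pp.n + 1) → Fin (2 ^ L)) × (Fin pp.m → Bool) => T.eval (pp.seedTable L ω.1 ω.2)) -
      uProb (fun y : Fin (2 ^ pp.n) → Bool => T.eval y)| ≤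
      (pp.n + 1 : ℕ) * ((pp.Q : ℝ) / 2 ^ L) + pp.n * ((2 ^ pp.n : ℕ) * ε) + (2 ^ pp.n : ℕ) / (2 * Real.sqrt pp.Q) := by
  have hg : pp.gpow pp.Q = 1 := by
    rw [gpow, ← hord]; exact pow_orderOf_eq_one _
  have h1 := abs_uProb_seedTable_sub_keyTable_le hg L T.eval
  have h2 := abs_uProb_hybTable_le hP hQ hg T hT hε H
  rw [uProb_hybTable_zero T.eval] at h2
  have h3 := abs_uProb_hybTable_n_sub_uniform_le hP hord T.eval
  calc |uProb (fun ω : (Fin (pp.n + 1) → Fin (2 ^ L)) × (Fin pp.m → Bool) => T.eval (pp.seedTable L ω.1 ω.2)) -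
        uProb (fun y : Fin (2 ^ pp.n) → Bool => T.eval y)|
      = |(uProb (fun ω : (Fin (pp.n + 1) → Fin (2 ^ L)) × (Fin pp.m → Bool) => T.eval (pp.seedTable L ω.1 ω.2)) -
            uProb (fun κ : pp.KeyΩ => T.eval (pp.keyTable κ.1 κ.2))) +
          ((uProb (fun κ : pp.KeyΩ => T.eval (pp.keyTable κ.1 κ.2)) -
            uProb (fun ω : pp.HΩ => T.eval (pp.hybTable pp.n ω))) +
          (uProb (fun ω : pp.HΩ => T.eval (pp.hybTable pp.n ω)) -
            uProb (fun y : Fin (2 ^ pp.n) → Bool => T.eval y)))| := by ring_nf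
    _ ≤ |uProb (fun ω : (Fin (pp.n + 1) → Fin (2 ^ L)) × (Fin pp.m → Bool) => T.eval (pp.seedTable L ω.1 ω.2)) -
            uProb (fun κ : pp.KeyΩ => T.eval (pp.keyTable κ.1 κ.2))| +
          (|uProb (fun κ : pp.KeyΩ => T.eval (pp.keyTable κ.1 κ.2)) -
            uProb (fun ω : pp.HΩ => T.eval (pp.hybTable pp.n ω))| +
          |uProb (fun ω : pp.HΩ => T.eval (pp.hybTable pp.n ω)) -
            uProb (fun y : Fin (2 ^ pp.n) → Bool => T.eval y)|) :=
        (abs_add_le _ _).trans (add_le_add le_rfl (abs_add_le _ _))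
    _ ≤ _ := by linarith

end Params

end NaorReingold

end Literature.Computability.Cryptography

end
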